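import Summits.QuantumFields.YangMills.Theorems.AllWindowsColdBoxBoxHighLineAssemblyFinalStep
import Summits.QuantumFields.YangMills.Theorems.AllWindowsColdBoxBoxHighLineBoxToChartRelative
import Summits.QuantumFields.YangMills.Theorems.AllWindowsColdBoxBoxHighLineTiltTruncation
import Summits.QuantumFields.YangMills.Theorems.AllWindowsColdBoxBoxHighLineTiltCovZeroMain
import Summits.QuantumFields.YangMills.Theorems.AllWindowsColdBoxBoxHighLineSmallFieldInsideFPByName
import Summits.QuantumFields.YangMills.Theorems.AllWindowsColdBoxBoxHighLineGaussianSmallFieldTail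
import Summits.QuantumFields.YangMills.Theorems.AllWindowsColdBoxBoxHighLineSmallFieldMass
import Summits.QuantumFields.YangMills.Theorems.AllWindowsColdBoxBoxHighLineAssemblyEpsTwoBudget
import Summits.QuantumFields.YangMills.Theorems.AllWindowsColdBoxBoxHighLinePlaqCostSizesOnD

/-!
# T-S5.13 final bookkeeping, part 2 — `landauSecondOrder_of (hK3) (hK4) : «stub_landauSecondOrder, v13»`
# (LEAD ym-line-sfw-p2 g77 GO 2026-08-29T21:36:42Z «w3 = hands for the v13 final bookkeeping, under LEAD letters»; ASSEMBLY-S5.md,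
# `g77-ASSEMBLY-E2-memo.md`; skeleton `Cruxes/BoxHighWindowsSU22/Lines/landau_sector_relative_bl.lean` v13 017557256013; LINE-19 S5
# ⟨stmt-QuantumFields-24004⟩/⟨24335⟩)

Width seat `ym-line-sfw-p2-w3` (g40).  NO new analysis: every inequality is a tree theorem cited by name; this file only chooses the parameters
(the v13 point `κ₃ = (1+16θ)/36`, `ε₁ = (5+8θ)/36`, valid for every `0 < θ < 5/64`) and adds up the error budget.

* Target shape = the v13 stub `stub_landauSecondOrder` with the Theorems-side copies of the line's Props (✓`…BoxHighWindowsSU22LineDefs`,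
  ✓`…BulkCurrency.LandauRelativeComparisonBulk`; the skeleton's own copies are definitionally equal).  The S1–S4 hypotheses are not used
  (ASSEMBLY-S5 §0: their content is in the tree by name).
* The two remaining inputs enter as HYPOTHESES with their posted statements VERBATIM: `hK3` = fcl-p3 g26's
  `GaussNormalForm.abs_tiltCum3_muD_zero_chartPlaqCost_le_sizes` (13K-K3, `…TiltCum3Sizes`), `hK4` = w5 g23's
  `GaussNormalForm.abs_tiltCum4_muD_le_rpow` (13K-K4, `…TiltCum4Bound`); the by-name one-liner `landauSecondOrder_of K3 K4` follows their landing.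
* Chain (ε₁ = ε₂ = 1/8 in ✓`landauRelativeComparisonBulk_of_split`): ε₁-half = ✓13A `BoxToChart.boxPlaqCov_sub_chartCov_relative smallFieldInsideFP`;
  ε₂-half = ✓13D `GaussNormalForm.cov_fpChartWeight_eq` (chart covariance = `tiltCov μ_D (tiltU) 1`) + ✓13u `abs_tiltCov_sub_sub_tiltCum3_le_muD`
  (with `hK4`, `|tiltU| ≤ 1` on `D` by ✓`TiltSup.exists_forall_abs_tiltU_le_one`, `hD` by ✓`GaussTail.exists_beta0_half_le_gaussAvg_sfInd`) + `hK3`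
  + ✓13f₀ `abs_sq_mul_tiltCov_muD_zero_sub_main_le` (τ = E₀[1 − 1_D] ≤ ✓6g) + floor ✓`BoxToChart.boxDirCircSqCov_floor_H` + the largeness
  conditions ✓`AssemblyBudget.k3_budget/k4_budget/f0_budget/side_budget`.

HONEST LABEL: the CONDITIONAL final assembly of the XL stub S5 of a critic-PASSed DRAFT line (conditional on K3, K4 — both submitted by their
holders); S5 by name, U5, ⟨24004⟩ ⟨24335⟩ ⟨24336⟩ remain OPEN; no crux, rung or summit is proved; **the Yang–Mills mass gap is NOT proved by this file.**
-/

set_option autoImplicit false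

noncomputable section

open MeasureTheory
open Literature.Probability.LatticeModels (Site)
open Literature.MathematicalPhysics.QuantumLattice (fundamentalRep)
open Summit.QuantumFields.YangMills.Theorems.WeakCouplingRates

namespace Summit.QuantumFields.YangMills.Theorems.AllWindowsColdBoxBoxHighLine

namespace AssemblyFinal

/-! ## Pure bookkeeping of the ε₂ errors -/

/-- The ε₂ arithmetic: three error pieces, each `≤ e/H⁸ = f₀/32`, with `f₀ ≤ main`, give `|β²·tc₁ − main| ≤ (1/8)·main`. -/
theorem eps_two_arith {tc₁ tc₀ k₃ main K₄ K₃ τ τb e H8 β Cf : ℝ} (hH8 : 0 < H8)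
    (h13u : |tc₁ - tc₀ - k₃| ≤ K₄ / 2) (hK3 : |k₃| ≤ K₃) (hf0 : |β ^ 2 * tc₀ - main| ≤ 96 * τ * β ^ 2 + Cf / β)
    (hτ : τ ≤ τb) (bK4 : β ^ 2 * H8 / 2 * K₄ ≤ e) (bK3 : β ^ 2 * H8 * K₃ ≤ e) (bf0 : (96 * τb * β ^ 2 + Cf / β) * H8 ≤ e)
    (hfloor : 32 * e / H8 ≤ main) : |β ^ 2 * tc₁ - main| ≤ 1 / 8 * main := by
  have hβ2 : 0 ≤ β ^ 2 := sq_nonneg β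
  have hsplit : β ^ 2 * tc₁ - main = β ^ 2 * (tc₁ - tc₀ - k₃) + β ^ 2 * k₃ + (β ^ 2 * tc₀ - main) := by ring
  have h1 : |β ^ 2 * tc₁ - main| ≤ β ^ 2 * |tc₁ - tc₀ - k₃| + β ^ 2 * |k₃| + |β ^ 2 * tc₀ - main| := by
    rw [hsplit]
    refine (abs_add_le _ _).trans (add_le_add ((abs_add_le _ _).trans (add_le_add ?_ ?_)) le_rfl)
    · rw [abs_mul, abs_of_nonneg hβ2]
    · rw [abs_mul, abs_of_nonneg hβ2]
  have h2 : β ^ 2 * |tc₁ - tc₀ - k₃| ≤ e / H8 := by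
    rw [le_div_iff₀ hH8]
    calc β ^ 2 * |tc₁ - tc₀ - k₃| * H8 ≤ β ^ 2 * (K₄ / 2) * H8 :=
          mul_le_mul_of_nonneg_right (mul_le_mul_of_nonneg_left h13u hβ2) hH8.le
      _ = β ^ 2 * H8 / 2 * K₄ := by ring
      _ ≤ e := bK4
  have h3 : β ^ 2 * |k₃| ≤ e / H8 := by
    rw [le_div_iff₀ hH8]
    calc β ^ 2 * |k₃| * H8 ≤ β ^ 2 * K₃ * H8 := mul_le_mul_of_nonneg_right (mul_le_mul_of_nonneg_left hK3 hβ2) hH8.le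
      _ = β ^ 2 * H8 * K₃ := by ring
      _ ≤ e := bK3
  have h4 : |β ^ 2 * tc₀ - main| ≤ e / H8 := by
    rw [le_div_iff₀ hH8]
    have : 96 * τ * β ^ 2 + Cf / β ≤ 96 * τb * β ^ 2 + Cf / β := by nlinarith
    calc |β ^ 2 * tc₀ - main| * H8 ≤ (96 * τb * β ^ 2 + Cf / β) * H8 := mul_le_mul_of_nonneg_right (hf0.trans this) hH8.le
      _ ≤ e := bf0
  have h5 : |β ^ 2 * tc₁ - main| ≤ 3 * (e / H8) := by linarith
  have h6 : 3 * (e / H8) = 3 / 32 * (32 * e / H8) := by ring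
  have hmain : 0 ≤ main := le_trans (by positivity : (0 : ℝ) ≤ |β ^ 2 * tc₁ - main|) (by nlinarith [abs_nonneg (β ^ 2 * tc₁ - main)])
  nlinarith

end AssemblyFinal

open AssemblyFinal AssemblyBudget in
/-- ★★★ **T-S5.13 — the v13 stub `stub_landauSecondOrder` BY SHAPE, CONDITIONAL on 13K-K3 (`hK3`, fcl-p3 g26) and 13K-K4 (`hK4`, w5 g23).**
For every `θL < 5/64` the BULK relative Dirichlet comparison `LandauRelativeComparisonBulk θL` holds (the S1–S4 hypotheses of the stub are carried
but unused: their content is in the tree by name). -/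
theorem landauSecondOrder_of
    (hK3 : ∃ CE CO CU c₀ : ℝ, ∃ m : ℕ, 0 ≤ CE ∧ 0 ≤ CO ∧ 0 ≤ CU ∧ 0 < c₀ ∧ ∀ H : ℕ, 1 ≤ H → ∀ β : ℝ, (H : ℝ) ^ 4 ≤ β →
      ∀ s : ℝ, 0 < s → s ≤ 1 → s * (H : ℝ) ^ 2 ≤ c₀ → 1 / 2 ≤ gaussAvg β H (sfInd H s) → ∀ x y : Site 4,
        |Tilt.tiltCum3 (((volume : Measure (LandauFree H → E3)).restrict (smallField H s)).withDensity fun a => ENNReal.ofReal (gaussWeight β H a))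
            (tiltU β H) 0 (chartPlaqCost H x 1 2) (chartPlaqCost H y 1 2)| ≤
          Real.sqrt CE * (1 + Real.log H) ^ 2 / β ^ 2 * Real.sqrt (CU * (1 + Real.log H) ^ m) *
              ((H : ℝ) ^ 4 / β + (H : ℝ) ^ 6 * s ^ 3 + (H : ℝ) ^ 4 * s ^ 4) +
            Real.sqrt (Real.sqrt CE * (1 + Real.log H) ^ 2 / β ^ 2 * (Real.sqrt CO * s ^ 3 / (β * Real.sqrt β))) * Real.sqrt (CU * (1 + Real.log H) ^ m) *
              ((H : ℝ) ^ 2 / Real.sqrt β + (H : ℝ) ^ 6 * s ^ 3 + (H : ℝ) ^ 4 * s ^ 4) +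
            Real.sqrt (Real.sqrt CO * s ^ 3 / (β * Real.sqrt β) * (Real.sqrt CE * (1 + Real.log H) ^ 2 / β ^ 2)) * Real.sqrt (CU * (1 + Real.log H) ^ m) *
              ((H : ℝ) ^ 2 / Real.sqrt β + (H : ℝ) ^ 6 * s ^ 3 + (H : ℝ) ^ 4 * s ^ 4) +
            Real.sqrt CO * s ^ 3 / (β * Real.sqrt β) * Real.sqrt (CU * (1 + Real.log H) ^ m) *
              ((H : ℝ) ^ 4 / β + (H : ℝ) ^ 6 * s ^ 3 + (H : ℝ) ^ 4 * s ^ 4))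
    (hK4 : ∃ C c₀ : ℝ, ∃ m : ℕ, 0 < c₀ ∧ 0 ≤ C ∧ ∀ H : ℕ, 1 ≤ H → ∀ β : ℝ, (H : ℝ) ^ 4 ≤ β →
      ∀ κ₃ : ℝ, 0 ≤ κ₃ → κ₃ ≤ 1 / 6 → β ^ (-1 / 2 + κ₃) * (H : ℝ) ^ 2 ≤ c₀ →
      (∀ a ∈ smallField H (β ^ (-1 / 2 + κ₃)), |tiltU β H a| ≤ 1) → 1 / 2 ≤ gaussAvg β H (sfInd H (β ^ (-1 / 2 + κ₃))) →
      ∀ (x y : Site 4), ∀ t ∈ Set.Icc (0 : ℝ) 1,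
        |Tilt.tiltCum4 ((volume.restrict (smallField H (β ^ (-1 / 2 + κ₃)))).withDensity fun a => ENNReal.ofReal (gaussWeight β H a))
            (tiltU β H) t (chartPlaqCost H x 1 2) (chartPlaqCost H y 1 2)| ≤
          C * (1 + Real.log H) ^ m *
            (2 * ((H : ℝ) ^ 4 / β ^ 3) + 8 * ((H : ℝ) ^ 8 * β ^ (-4 + 4 * κ₃)) + 4 * ((H : ℝ) ^ 12 * β ^ (-5 + 10 * κ₃)))) :
    ∀ θL : ℝ, θL < 5 / 64 → HodgePoincareColdBox → DirProjKernelHodgeForm → LandauVarianceBounded ∧ LandauKernelDecay → LandauBootstrapBound →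
      (∃ κ : ℝ, 0 < κ ∧ κ < 1 / 2 - 3 * θL ∧ GaugeBallReduction θL κ) → LandauRelativeComparisonBulk θL := by
  intro θL hθL _ _ _ _ _
  refine landauRelativeComparisonBulk_of_split θL fun θ hθ hθle => ?_
  have hθu : θ < 5 / 64 := lt_of_le_of_lt hθle hθL
  -- global constants of the by-name inputs
  obtain ⟨CE, CO, CU, c₃, m₃, hCE, hCO, hCU, hc₃, hK3⟩ := hK3
  obtain ⟨C₄, c₄, m₄, hc₄, hC₄, hK4⟩ := hK4
  obtain ⟨C₆, c₆, hc₆, h6g⟩ := gaussianSmallFieldTail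
  obtain ⟨Cf, hf0⟩ := GaussNormalForm.abs_sq_mul_tiltCov_muD_zero_sub_main_le
  obtain ⟨Mf, Lf, hMf, hLf, hfloor⟩ := BoxToChart.boxDirCircSqCov_floor_H
  -- the v13 parameter point
  set κ₃ : ℝ := (1 + 16 * θ) / 36 with hκ₃
  set ε₁ : ℝ := (5 + 8 * θ) / 36 with hε₁
  have hκl : θ / 2 < κ₃ := by rw [hκ₃]; linarith
  have hε₁l : κ₃ < ε₁ := by rw [hκ₃, hε₁]; linarith
  have hε₁θ : 2 * θ < ε₁ := by rw [hε₁]; linarith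
  have hε₁u : ε₁ < 1 / 2 - 4 * θ := by rw [hε₁]; linarith
  have hε₁u' : ε₁ < 1 / 2 - 6 * θ + 2 * κ₃ := by rw [hκ₃, hε₁]; linarith
  have hκu : κ₃ < (1 / 2 - 4 * θ) / 3 := by rw [hκ₃]; linarith
  have hκ₃0 : 0 < κ₃ := by rw [hκ₃]; linarith
  have hκ₃6 : κ₃ ≤ 1 / 6 := by rw [hκ₃]; linarith
  have h12 : 12 * θ < 1 := by linarith
  have h4 : 4 * θ < 1 := by linarith
  have h8 : 8 * θ < 1 := by linarith
  have h2 : 2 * θ < 1 / 2 - κ₃ := by rw [hκ₃]; linarith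
  -- 13A (the ε₁-half and the letters K, M₁, L₁)
  obtain ⟨K, M₁, L₁, hK, hM₁, hL₁, β₁, hβ₁, hA⟩ :=
    BoxToChart.boxPlaqCov_sub_chartCov_relative smallFieldInsideFP hθ hκl hε₁l hε₁θ hε₁u hε₁u'
  -- the largeness conditions
  have he : (0 : ℝ) < 3 / (1024 * Real.pi ^ 4) := by positivity
  obtain hb3 := k3_budget hθ hθu hκ₃ he CE CO hCU m₃
  obtain hb4 := k4_budget (C := C₄) hθ hθu hκ₃ he m₄
  obtain hbf := f0_budget hθ.le h8 hκ₃0 hc₆ he C₆ Cf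
  obtain hbs := side_budget (c := min c₃ c₄) hθ h4 h2 (lt_min hc₃ hc₄) 32
  obtain hbU := TiltSup.exists_forall_abs_tiltU_le_one hθ h12 hκu
  obtain hbD := GaussTail.exists_beta0_half_le_gaussAvg_sfInd hθ.le hκ₃0
  obtain ⟨βr, hβr, hbr⟩ := exists_beta0_one_le_mul_rpow hK (sub_pos.2 hε₁l)
  have hbr' : ∃ β₀ : ℝ, 1 ≤ β₀ ∧ ∀ β : ℝ, β₀ ≤ β → ∀ _H : ℕ, 1 ≤ K * β ^ (ε₁ - κ₃) := ⟨βr, hβr, fun β hβ _ => hbr β hβ⟩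
  obtain ⟨β₀, hβ₀, hall⟩ := ErrorBudget.exists_forall_and ⟨β₁, hβ₁, hA⟩ (ErrorBudget.exists_forall_and hb3 (ErrorBudget.exists_forall_and hb4
    (ErrorBudget.exists_forall_and hbf (ErrorBudget.exists_forall_and hbs (ErrorBudget.exists_forall_and hbU
    (ErrorBudget.exists_forall_and hbD hbr'))))))
  clear hA hb3 hb4 hbf hbs hbU hbD hbr hbr'
  -- the split data: Φ := β²·(chart covariance), M, L, β₀, ε₁' = ε₂' = 1/8
  refine ⟨fun β T => β ^ 2 *
      ((∫ a in smallField ⌈β ^ θ⌉₊ (β ^ (κ₃ - 1 / 2)),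
          chartPlaqCost ⌈β ^ θ⌉₊ (boxCentre ⌈β ^ θ⌉₊) 1 2 a * chartPlaqCost ⌈β ^ θ⌉₊ (boxCentre ⌈β ^ θ⌉₊ + Pi.single 0 (T : ℤ)) 1 2 a *
            fpChartWeight β ⌈β ^ θ⌉₊ (K * ⌈β ^ θ⌉₊ * (1 + Real.log ⌈β ^ θ⌉₊) ^ 2 * β ^ (ε₁ - 1 / 2) +
              1 / ((⌈β ^ θ⌉₊ : ℝ) ^ 4 * (1 + Real.log β) ^ 2)) a) /
          (∫ a in smallField ⌈β ^ θ⌉₊ (β ^ (κ₃ - 1 / 2)),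
            fpChartWeight β ⌈β ^ θ⌉₊ (K * ⌈β ^ θ⌉₊ * (1 + Real.log ⌈β ^ θ⌉₊) ^ 2 * β ^ (ε₁ - 1 / 2) +
              1 / ((⌈β ^ θ⌉₊ : ℝ) ^ 4 * (1 + Real.log β) ^ 2)) a) -
        (∫ a in smallField ⌈β ^ θ⌉₊ (β ^ (κ₃ - 1 / 2)),
            chartPlaqCost ⌈β ^ θ⌉₊ (boxCentre ⌈β ^ θ⌉₊) 1 2 a *
              fpChartWeight β ⌈β ^ θ⌉₊ (K * ⌈β ^ θ⌉₊ * (1 + Real.log ⌈β ^ θ⌉₊) ^ 2 * β ^ (ε₁ - 1 / 2) +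
                1 / ((⌈β ^ θ⌉₊ : ℝ) ^ 4 * (1 + Real.log β) ^ 2)) a) /
            (∫ a in smallField ⌈β ^ θ⌉₊ (β ^ (κ₃ - 1 / 2)),
              fpChartWeight β ⌈β ^ θ⌉₊ (K * ⌈β ^ θ⌉₊ * (1 + Real.log ⌈β ^ θ⌉₊) ^ 2 * β ^ (ε₁ - 1 / 2) +
                1 / ((⌈β ^ θ⌉₊ : ℝ) ^ 4 * (1 + Real.log β) ^ 2)) a) *
          ((∫ a in smallField ⌈β ^ θ⌉₊ (β ^ (κ₃ - 1 / 2)),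
              chartPlaqCost ⌈β ^ θ⌉₊ (boxCentre ⌈β ^ θ⌉₊ + Pi.single 0 (T : ℤ)) 1 2 a *
                fpChartWeight β ⌈β ^ θ⌉₊ (K * ⌈β ^ θ⌉₊ * (1 + Real.log ⌈β ^ θ⌉₊) ^ 2 * β ^ (ε₁ - 1 / 2) +
                  1 / ((⌈β ^ θ⌉₊ : ℝ) ^ 4 * (1 + Real.log β) ^ 2)) a) /
            (∫ a in smallField ⌈β ^ θ⌉₊ (β ^ (κ₃ - 1 / 2)),
              fpChartWeight β ⌈β ^ θ⌉₊ (K * ⌈β ^ θ⌉₊ * (1 + Real.log ⌈β ^ θ⌉₊) ^ 2 * β ^ (ε₁ - 1 / 2) +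
                1 / ((⌈β ^ θ⌉₊ : ℝ) ^ 4 * (1 + Real.log β) ^ 2)) a))),
    max M₁ (8 * Mf), max L₁ Lf, β₀, 1 / 8, 1 / 8, le_max_of_le_left hM₁, by norm_num, ?_, ?_⟩
  · -- the ε₁-half: ✓13A verbatim
    intro β hβ T hLT hMT
    obtain ⟨hAβ, -⟩ := hall β hβ T
    have hM : M₁ * (T : ℝ) ≤ (⌈β ^ θ⌉₊ : ℝ) := (mul_le_mul_of_nonneg_right (le_max_left _ _) T.cast_nonneg).trans hMT
    exact hAβ ((le_max_left _ _).trans hLT) hM ⌈β ^ θ⌉₊ _ _ _ rfl rfl rfl rfl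
  · -- the ε₂-half
    intro β hβ T hLT hMT
    have hβ1 : 1 ≤ β := hβ₀.trans hβ
    have hβpos : 0 < β := by linarith only [hβ1]
    obtain ⟨hHl, hHu, hH1⟩ := BoxToChart.ceil_rpow_bounds (θ := θ) hβ1
    obtain ⟨-, hb3β, hb4β, hbfβ, hbsβ, hbUβ, hbDβ, hbrβ⟩ := hall β hβ ⌈β ^ θ⌉₊
    clear hall
    dsimp only
    set H : ℕ := ⌈β ^ θ⌉₊ with hHdef
    set s : ℝ := β ^ (κ₃ - 1 / 2) with hsdef
    set r : ℝ := K * (H : ℝ) * (1 + Real.log (H : ℝ)) ^ 2 * β ^ (ε₁ - 1 / 2) + 1 / ((H : ℝ) ^ 4 * (1 + Real.log β) ^ 2) with hrdef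
    have hse : β ^ (-1 / 2 + κ₃) = s := by rw [hsdef]; congr 1; ring
    have hs0 : 0 < s := by rw [hsdef]; exact Real.rpow_pos_of_pos hβpos _
    clear_value H s r
    have hH1' : (1 : ℝ) ≤ H := by exact_mod_cast hH1
    have hH0 : (0 : ℝ) < H := by linarith only [hH1']
    have hH8 : (0 : ℝ) < (H : ℝ) ^ 8 := pow_pos hH0 8
    -- side conditions at this β
    obtain ⟨hH4β, hsH2, h252, h32, hs1⟩ := hbsβ hH1 hHl hHu
    have hsπ : s < Real.pi := lt_of_le_of_lt hs1 (by linarith only [Real.pi_gt_three])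
    have hU1 : ∀ a ∈ smallField H s, |tiltU β H a| ≤ 1 := by
      have h := hbUβ hH1 hHu
      rw [hse] at h
      exact h
    obtain ⟨hD, hDpos⟩ := hbDβ hH1 hHu
    have hKβ : 1 ≤ K * β ^ (ε₁ - κ₃) := hbrβ
    -- `s ≤ r` and `0 < r`
    have hlogH : 0 ≤ Real.log (H : ℝ) := Real.log_nonneg hH1'
    have htiny : 0 ≤ 1 / ((H : ℝ) ^ 4 * (1 + Real.log β) ^ 2) :=
      one_div_nonneg.2 (mul_nonneg (pow_nonneg hH0.le 4) (sq_nonneg _))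
    have hspl : 0 < β ^ (ε₁ - 1 / 2) := Real.rpow_pos_of_pos hβpos _
    have hsr : s ≤ r := by
      have h1 : s ≤ K * β ^ (ε₁ - 1 / 2) := by
        have h := mul_le_mul_of_nonneg_left hKβ hs0.le
        rw [mul_one] at h
        refine h.trans (le_of_eq ?_)
        rw [hsdef, mul_left_comm, ← Real.rpow_add hβpos]
        congr 2; ring
      have h2 : K * β ^ (ε₁ - 1 / 2) ≤ K * (H : ℝ) * (1 + Real.log (H : ℝ)) ^ 2 * β ^ (ε₁ - 1 / 2) := by
        have hHL : (1 : ℝ) ≤ (H : ℝ) * (1 + Real.log (H : ℝ)) ^ 2 :=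
          one_le_mul_of_one_le_of_one_le hH1' (one_le_pow₀ (by linarith only [hlogH]))
        have := mul_le_mul_of_nonneg_left hHL (mul_nonneg hK.le hspl.le)
        calc K * β ^ (ε₁ - 1 / 2) = K * β ^ (ε₁ - 1 / 2) * 1 := by ring
          _ ≤ K * β ^ (ε₁ - 1 / 2) * ((H : ℝ) * (1 + Real.log (H : ℝ)) ^ 2) := this
          _ = _ := by ring
      rw [hrdef]
      linarith only [h1, h2, htiny]
    have hr : 0 < r := lt_of_lt_of_le hs0 hsr
    -- 13f₀ and 6g at this β (before the base point `boxCentre H + e₀·T` is generalized)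
    have hτ2 : gaussAvg β H (fun a => 1 - sfInd H s a) ≤ 1 / 2 := by
      have := GaussTail.gaussAvg_sfInd_eq (H := H) hβpos s
      linarith only [this, hD]
    have hf := hf0 H hH1 β hβ1 s _ le_rfl hτ2 T
    have hτb := h6g H hH1 β s hβpos hs0
    -- generalize the second base point (elaborating it inline inside term-mode applications is pathological)
    generalize hy : boxCentre H + Pi.single 0 (T : ℤ) = y at hf ⊢
    -- the chart covariance is the tilted covariance at t = 1 (13D)
    have hdet := GaussNormalForm.det_fpOperator_edgeChart_ne_zero (H := H) hH1 hs0.le hs1 h252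
    have hcov := GaussNormalForm.cov_fpChartWeight_eq (β := β) hH1 hs0.le hsr hsπ hr hdet
      (chartPlaqCost H (boxCentre H) 1 2) (chartPlaqCost H y 1 2)
    rw [hcov]
    clear hcov hdet
    -- K4, 13u, K3 at this β
    have hK4i : ∀ t ∈ Set.Icc (0 : ℝ) 1,
        |Tilt.tiltCum4 ((volume.restrict (smallField H s)).withDensity fun a => ENNReal.ofReal (gaussWeight β H a))
            (tiltU β H) t (chartPlaqCost H (boxCentre H) 1 2) (chartPlaqCost H y 1 2)| ≤
          C₄ * (1 + Real.log H) ^ m₄ *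
            (2 * ((H : ℝ) ^ 4 / β ^ 3) + 8 * ((H : ℝ) ^ 8 * β ^ (-4 + 4 * κ₃)) + 4 * ((H : ℝ) ^ 12 * β ^ (-5 + 10 * κ₃))) := by
      have h := hK4 H hH1 β hH4β κ₃ hκ₃0.le hκ₃6
      rw [hse] at h
      exact h (hsH2.trans (min_le_right _ _)) hU1 hD _ _
    have hUb4 : ∀ a ∈ smallField H s, |tiltU β H a| ≤ 4 := fun a ha => (hU1 a ha).trans (by norm_num)
    have hb₁ : ∀ a, |chartPlaqCost H (boxCentre H) 1 2 a| ≤ 4 := fun a => TiltSup.abs_chartPlaqCost_le_four (boxCentre H) 1 2 a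
    have hb₂ : ∀ a, |chartPlaqCost H y 1 2 a| ≤ 4 := fun a => TiltSup.abs_chartPlaqCost_le_four y 1 2 a
    have h13u := GaussNormalForm.abs_tiltCov_sub_sub_tiltCum3_le_muD hβpos hs0
      (EdgeChartGaussian.measurable_chartPlaqCost H (boxCentre H) 1 2) (EdgeChartGaussian.measurable_chartPlaqCost H y 1 2) hb₁ hb₂ hUb4 hK4i
    have hK3i := hK3 H hH1 β hH4β s hs0 hs1 (hsH2.trans (min_le_left _ _)) hD (boxCentre H) y
    -- budgets at this β
    have bK3 := hb3β hH1 hHu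
    have bK4 := hb4β hH1 hHu
    have bf0 := hbfβ hH1 hHu
    -- the floor on the bulk window
    have hMT' : Mf * (T : ℝ) ≤ (H : ℝ) / 8 := by
      have h1 : 8 * Mf * (T : ℝ) ≤ (H : ℝ) := (mul_le_mul_of_nonneg_right (le_max_right _ _) T.cast_nonneg).trans hMT
      linarith only [h1]
    have hLT' : Lf ≤ (T : ℝ) := (le_max_right _ _).trans hLT
    have hfl := hfloor H h32 T hMT' hLT'
    have hfl' : 32 * (3 / (1024 * Real.pi ^ 4)) / (H : ℝ) ^ 8 ≤ 3 / 4 * boxDirCircSqCov H T := by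
      refine le_trans (le_of_eq ?_) hfl
      field_simp
      ring
    clear hK3 hK4 hf0 h6g hfloor hb3β hb4β hbfβ hbsβ hbUβ hbDβ hfl
    exact eps_two_arith hH8 h13u hK3i hf hτb bK4 bK3 bf0 hfl'
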